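import Mathlib
import HarnessLib
import Summits.HodgeConjecture.HodgeConjecture.Theorems.WeilTwelvefoldsSqrtMinus7.Negative.EigenvalueTyping
import Summits.HodgeConjecture.HodgeConjecture.Theorems.HeckePrymWeilHyperbolicEightfoldsSqrtMinus7AbstractSwitchVeronese
import Summits.HodgeConjecture.HodgeConjecture.Theorems.HeckePrymWeilHyperbolicEightfoldsSqrtMinus7AbstractSwitchEigenline
import Summits.HodgeConjecture.HodgeConjecture.Theorems.HeckePrymWeilHyperbolicEightfoldsSqrtMinus7AbstractSwitchNormalForm

/-!
# `HyperbolicEightfoldsSqrtMinus7` (stmt-HodgeConjecture-14642) · line `Sketch` · stub `stub_abstractSwitch`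

The ABSTRACT QUATERNION FIELD SWITCH (pure linear algebra), stub 1 of the skeleton of the line
`Sketch` (idea `dicyclic-quaternion-switch`) for the crux `HeckePrymWeil.HyperbolicEightfoldsSqrtMinus7`.

Let `V` be a 16-dimensional `ℂ`-vector space and `F, G ∈ End V` with `F² = -7`, `G² = -3m²`,
`FG + GF = t ∈ ℤ`, `t² < 84m²`.  Then every vector of the `(1+F)`-typed plane
`Eig(⋀⁸(1+F), (1+i√7)⁸) ⊔ Eig(⋀⁸(1+F), (1-i√7)⁸) ⊂ ⋀⁸V` lies in the sum over `k = 0, …, 8` of the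
images under `⋀⁸(k·1 + F)` of the `(2m+G)`-typed plane
`Eig(⋀⁸(2m+G), m⁸(2+i√3)⁸) ⊔ Eig(⋀⁸(2m+G), m⁸(2-i√3)⁸)`.

Proof (files `…AbstractSwitchNormalForm`, `…AbstractSwitchEigenline`, `…AbstractSwitchVeronese`):
(a) `G₁ = G + (t/14)F` anticommutes with `F`, `G₁² = -r² ≠ 0`; `V = V⁺ ⊕ V⁻` (`F = ± i√7`),
`dim V± = 8`, basis `u` of `V⁺`, `w = G₁u` of `V⁻`.  (b) In the basis `(u, w)` the operator `1 + F`
is diagonal with eigenvalues `1 ± i√7`; by the separation `(1+i√7)^a(1-i√7)^b = (1+i√7)^{a+b} ↔ b = 0`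
(`Negative.EigenvalueTyping`) the two typed eigenspaces of `⋀⁸(1+F)` are the LINES `ℂ·∧u`, `ℂ·∧w`.
(c) `v = α₊u + w` (`α₊ = i√3m - (t/14)i√7 ≠ 0`) satisfies `Gv = i√3m·v`, so `∧v` lies in the
`(2m+G)`-typed plane, and `⋀⁸(k+F)(∧v) = ∧((k+i√7)α₊u + (k-i√7)w)`: nine pairwise non-proportional
points of the pencil `ω(α,β) = ∧(αu + βw)`, a vector-valued binary octic; Vandermonde inversion puts
every `ω(α,β)`, in particular `∧u = ω(1,0)` and `∧w = ω(0,1)`, in their span.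
-/

-- `Summit.HodgeConjecture.HodgeConjecture.…` is the tree's mandated namespace (summit = problem name).
set_option linter.dupNamespace false

namespace Summit.HodgeConjecture.HodgeConjecture.Theorems.HyperbolicEightfoldsSqrtMinus7.DicyclicQuaternionSwitch

open Module Complex
open Summit.HodgeConjecture.HodgeConjecture.Theorems.WeilTwelvefoldsSqrtMinus7.Negative

/-- **The `σ₊`-eigenvector identity** of the `2 × 2` matrix of `G`: for `a² = -7` (`a = i√7`),
`b² = -3` (`b = i√3`), `μ = b·m`, `c = t/14`, `α = μ - c·a`, `r² = 3m² - t²/28` one has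
`-(α·c·a) - r² = μ·α`. [folklore] -/
theorem sigma_identity (a b : ℂ) (ha : a * a = -7) (hb : b * b = -3) (m : ℕ) (t : ℤ) :
    -((b * (m : ℂ) - (t : ℂ) / 14 * a) * ((t : ℂ) / 14 * a)) - (3 * (m : ℂ) ^ 2 - (t : ℂ) ^ 2 / 28) =
      (b * (m : ℂ)) * (b * (m : ℂ) - (t : ℂ) / 14 * a) := by
  linear_combination ((t : ℂ) / 14) ^ 2 * ha - (m : ℂ) ^ 2 * hb

/-- `α = b·m - (t/14)·a ≠ 0` when `t² < 84m²` (else `r² = 0`), for `a² = -7`, `b² = -3`. [folklore] -/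
theorem alpha_ne_zero (a b : ℂ) (ha : a * a = -7) (hb : b * b = -3) (m : ℕ) (t : ℤ)
    (ht : t ^ 2 < 84 * (m : ℤ) ^ 2) : (b * (m : ℂ) - (t : ℂ) / 14 * a) ≠ 0 := by
  intro h
  have hid := sigma_identity a b ha hb m t
  rw [h, zero_mul, neg_zero, zero_sub, mul_zero, neg_eq_zero] at hid
  exact rsq_ne_zero m t ht hid

/-- The nine ratios `((k + a)α)/(k - a)`, `k = 0..8`, are pairwise distinct when `a ≠ 0`, `α ≠ 0`
and no `k - a` vanishes (`a = i√7`). [folklore] -/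
theorem nodes_injective {a α : ℂ} (ha : a ≠ 0) (hk : ∀ k : ℕ, (k : ℂ) - a ≠ 0) (hα : α ≠ 0) :
    Function.Injective (fun k : Fin (8 + 1) => ((((k : ℕ) : ℂ) + a) * α) / (((k : ℕ) : ℂ) - a)) := by
  intro k l hkl
  simp only at hkl
  rw [div_eq_div_iff (hk k) (hk l)] at hkl
  have h2 : (2 * a * α) * (((l : ℕ) : ℂ) - ((k : ℕ) : ℂ)) = 0 := by linear_combination hkl
  have hne : (2 * a * α) ≠ 0 := mul_ne_zero (mul_ne_zero two_ne_zero ha) hα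
  have h3 : ((l : ℕ) : ℂ) = ((k : ℕ) : ℂ) := sub_eq_zero.1 ((mul_eq_zero.1 h2).resolve_left hne)
  exact Fin.ext (Nat.cast_injective h3).symm

/-- **Stub 1 — the ABSTRACT quaternion field switch (pure linear algebra).**  Let `V` be a
16-dimensional `ℂ`-vector space and `F, G ∈ End V` with `F² = -7`, `G² = -3m²` (`m ≥ 1`),
`FG + GF = t ∈ ℤ`, `t² < 84m²`.  Then every vector of the `(1+F)`-typed plane
`Eig(⋀⁸(1+F), (1+i√7)⁸) ⊔ Eig(⋀⁸(1+F), (1-i√7)⁸) ⊂ ⋀⁸V` lies in the sum over `k = 0, …, 8` of the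
images under `⋀⁸(k·1 + F)` of the `(2m+G)`-typed plane
`Eig(⋀⁸(2m+G), m⁸(2+i√3)⁸) ⊔ Eig(⋀⁸(2m+G), m⁸(2-i√3)⁸)`.  See the module docstring for the proof.
[folklore] -/
theorem stub_abstractSwitch :
    ∀ (V : Type) [AddCommGroup V] [Module ℂ V] [FiniteDimensional ℂ V],
      Module.finrank ℂ V = 16 →
    ∀ (F G : V →ₗ[ℂ] V) (m : ℕ) (t : ℤ), 0 < m →
      F ∘ₗ F = -((7 : ℂ) • LinearMap.id) →
      G ∘ₗ G = -((3 * (m : ℂ) ^ 2) • LinearMap.id) →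
      F ∘ₗ G + G ∘ₗ F = (t : ℂ) • LinearMap.id →
      t ^ 2 < 84 * (m : ℤ) ^ 2 →
    ∀ x : ⋀[ℂ]^8 V,
      x ∈ Module.End.eigenspace (exteriorPower.map 8 (LinearMap.id + F))
            ((1 + Complex.I * (Real.sqrt (7 : ℝ) : ℂ)) ^ 8) ⊔
          Module.End.eigenspace (exteriorPower.map 8 (LinearMap.id + F))
            ((1 - Complex.I * (Real.sqrt (7 : ℝ) : ℂ)) ^ 8) →
      x ∈ ⨆ k : Fin 9, Submodule.map (exteriorPower.map 8 (((k : ℕ) : ℂ) • LinearMap.id + F))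
          (Module.End.eigenspace (exteriorPower.map 8 ((2 * (m : ℂ)) • LinearMap.id + G))
              ((m : ℂ) ^ 8 * (2 + Complex.I * (Real.sqrt (3 : ℝ) : ℂ)) ^ 8) ⊔
            Module.End.eigenspace (exteriorPower.map 8 ((2 * (m : ℂ)) • LinearMap.id + G))
              ((m : ℂ) ^ 8 * (2 - Complex.I * (Real.sqrt (3 : ℝ) : ℂ)) ^ 8)) := by
  intro V _ _ _ hV F G m t _hm hF hG hFG ht x hx
  -- (a) quaternion normal form: the half-bases `u` (of `V⁺`) and `w = G₁ u` (of `V⁻`)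
  obtain ⟨u, hu, hli_u, hli_w, hdisj⟩ := exists_half_bases F G m t hV hF hG hFG ht
  -- the two quadratic irrationalities `a = i√7`, `b₃ = i√3`
  set a : ℂ := Complex.I * ((Real.sqrt (7 : ℝ) : ℝ) : ℂ) with ha_def
  set b₃ : ℂ := Complex.I * ((Real.sqrt (3 : ℝ) : ℝ) : ℂ) with hb₃_def
  have ha2 : a * a = -7 := rt7_mul_self
  have ha0 : a ≠ 0 := rt7_ne_zero
  have hka : ∀ k : ℕ, (k : ℂ) - a ≠ 0 := natCast_sub_rt7_ne_zero
  have hb2 : b₃ * b₃ = -3 := by rw [← sq]; exact I_mul_sqrt3_sq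
  set G₁ : V →ₗ[ℂ] V := G + ((t : ℂ) / 14) • F with hG₁
  set w : Fin 8 → V := fun i => G₁ (u i) with hw_def
  have hw : ∀ i, F (w i) = (-a) • w i := fun i =>
    Module.End.mem_eigenspace_iff.1 (corrected_mem_eigenspace_neg F G t hF hFG
      (Module.End.mem_eigenspace_iff.2 (hu i)))
  have hww : ∀ i, G₁ (w i) = -((3 * (m : ℂ) ^ 2 - (t : ℂ) ^ 2 / 28) • u i) := fun i =>
    corrected_sq F G m t hF hG hFG (u i)
  have hGy : ∀ y, G y = G₁ y - ((t : ℂ) / 14) • F y := fun y => by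
    simp only [hG₁, LinearMap.add_apply, LinearMap.smul_apply]; abel
  obtain ⟨b, hb₁, hb₂⟩ := exists_basis_of_halves hV u w hli_u hli_w hdisj
  obtain ⟨b', hb'₁, hb'₂⟩ := exists_basis_of_halves hV w u hli_w hli_u hdisj.symm
  -- (b) the two typed eigenspaces of `⋀⁸(1+F)` are the lines `ℂ ∧u` and `ℂ ∧w`
  have hT₁ : ∀ i : Fin 8,
      (LinearMap.id + F : V →ₗ[ℂ] V) (b (Fin.castAdd 8 i)) = (1 + a) • b (Fin.castAdd 8 i) := by
    intro i; rw [hb₁, LinearMap.add_apply, LinearMap.id_apply, hu, add_smul, one_smul]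
  have hT₂ : ∀ i : Fin 8,
      (LinearMap.id + F : V →ₗ[ℂ] V) (b (Fin.natAdd 8 i)) = (1 - a) • b (Fin.natAdd 8 i) := by
    intro i; rw [hb₂, LinearMap.add_apply, LinearMap.id_apply, hw, sub_smul, one_smul, neg_smul,
      sub_eq_add_neg]
  have hT'₁ : ∀ i : Fin 8,
      (LinearMap.id + F : V →ₗ[ℂ] V) (b' (Fin.castAdd 8 i)) = (1 - a) • b' (Fin.castAdd 8 i) := by
    intro i; rw [hb'₁, LinearMap.add_apply, LinearMap.id_apply, hw, sub_smul, one_smul, neg_smul,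
      sub_eq_add_neg]
  have hT'₂ : ∀ i : Fin 8,
      (LinearMap.id + F : V →ₗ[ℂ] V) (b' (Fin.natAdd 8 i)) = (1 + a) • b' (Fin.natAdd 8 i) := by
    intro i; rw [hb'₂, LinearMap.add_apply, LinearMap.id_apply, hu, add_smul, one_smul]
  have hsep₁ : ∀ j ≤ 8, (1 + a) ^ j * (1 - a) ^ (8 - j) = (1 + a) ^ 8 → j = 8 := by
    intro j hj h
    have h8 : j + (8 - j) = 8 := by omega
    have := (mixed_eq_plus_iff j (8 - j)).1 (by rw [h8]; exact h)
    omega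
  have hsep₂ : ∀ j ≤ 8, (1 - a) ^ j * (1 + a) ^ (8 - j) = (1 - a) ^ 8 → j = 8 := by
    intro j hj h
    have h8 : (8 - j) + j = 8 := by omega
    have := (mixed_eq_minus_iff (8 - j) j).1 (by rw [h8, mul_comm]; exact h)
    omega
  have hline₁ := extPow_eigenspace_le_line b (LinearMap.id + F) (1 + a) (1 - a) ((1 + a) ^ 8)
    hT₁ hT₂ hsep₁
  have hline₂ := extPow_eigenspace_le_line b' (LinearMap.id + F) (1 - a) (1 + a) ((1 - a) ^ 8)
    hT'₁ hT'₂ hsep₂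
  have hbu : (fun i => b (Fin.castAdd 8 i)) = u := funext hb₁
  have hbw : (fun i => b' (Fin.castAdd 8 i)) = w := funext hb'₁
  rw [hbu] at hline₁
  rw [hbw] at hline₂
  obtain ⟨y, hy, z, hz, rfl⟩ := Submodule.mem_sup.1 hx
  obtain ⟨cy, rfl⟩ := Submodule.mem_span_singleton.1 (hline₁ hy)
  obtain ⟨cz, rfl⟩ := Submodule.mem_span_singleton.1 (hline₂ hz)
  -- (c) the pencil `ω(α, β) = ∧(α u + β w)` and its nine special points
  set ω : ℂ → ℂ → ⋀[ℂ]^8 V := fun α β => exteriorPower.ιMulti ℂ 8 (fun i => α • u i + β • w i)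
    with hω_def
  suffices hall : ∀ α β : ℂ, ω α β ∈
      ⨆ k : Fin 9, Submodule.map (exteriorPower.map 8 (((k : ℕ) : ℂ) • LinearMap.id + F))
        (Module.End.eigenspace (exteriorPower.map 8 ((2 * (m : ℂ)) • LinearMap.id + G))
            ((m : ℂ) ^ 8 * (2 + b₃) ^ 8) ⊔
          Module.End.eigenspace (exteriorPower.map 8 ((2 * (m : ℂ)) • LinearMap.id + G))
            ((m : ℂ) ^ 8 * (2 - b₃) ^ 8)) by
    have h10 := hall 1 0
    have h01 := hall 0 1
    simp only [hω_def, one_smul, zero_smul, add_zero, zero_add] at h10 h01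
    exact Submodule.add_mem _ (Submodule.smul_mem _ _ h10) (Submodule.smul_mem _ _ h01)
  -- the `σ₊`-eigenvectors `v i = α u i + w i` of `G`, eigenvalue `μ = i√3 m`
  set μ : ℂ := b₃ * (m : ℂ) with hμ
  set α : ℂ := b₃ * (m : ℂ) - (t : ℂ) / 14 * a with hα
  have hα0 : α ≠ 0 := alpha_ne_zero a b₃ ha2 hb2 m t ht
  set v : Fin 8 → V := fun i => α • u i + w i with hv
  have hGv : ∀ i, G (v i) = μ • v i := by
    intro i
    have e1 : G (v i) = (-((b₃ * (m : ℂ) - (t : ℂ) / 14 * a) * ((t : ℂ) / 14 * a)) -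
        (3 * (m : ℂ) ^ 2 - (t : ℂ) ^ 2 / 28)) • u i + (α + (t : ℂ) / 14 * a) • w i := by
      simp only [hv, hGy, map_add, map_smul, hu, hw, hww]
      module
    rw [e1, sigma_identity a b₃ ha2 hb2 m t, show α + (t : ℂ) / 14 * a = μ by rw [hα, hμ]; ring]
    simp only [hv, hμ, hα]
    module
  have hvE : exteriorPower.ιMulti ℂ 8 v ∈
      Module.End.eigenspace (exteriorPower.map 8 ((2 * (m : ℂ)) • LinearMap.id + G))
        ((m : ℂ) ^ 8 * (2 + b₃) ^ 8) := by
    rw [Module.End.mem_eigenspace_iff, exteriorPower.map_apply_ιMulti]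
    have hfun : (⇑((2 * (m : ℂ)) • (LinearMap.id : V →ₗ[ℂ] V) + G) ∘ v) =
        fun i => (2 * (m : ℂ) + μ) • v i := by
      funext i
      rw [Function.comp_apply, LinearMap.add_apply, LinearMap.smul_apply, LinearMap.id_apply, hGv]
      module
    have hpow : (2 * (m : ℂ) + μ) ^ 8 = (m : ℂ) ^ 8 * (2 + b₃) ^ 8 := by
      rw [hμ]
      ring
    rw [hfun, AlternatingMap.map_smul_univ, Finset.prod_const, Finset.card_univ, Fintype.card_fin,
      hpow]
  -- the nine translates `⋀⁸(k + F)(∧v) = ω ((k + i√7)α) (k - i√7)` lie in the target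
  have hωk : ∀ k : Fin 9, ω ((((k : ℕ) : ℂ) + a) * α) (((k : ℕ) : ℂ) - a) ∈
      ⨆ k : Fin 9, Submodule.map (exteriorPower.map 8 (((k : ℕ) : ℂ) • LinearMap.id + F))
        (Module.End.eigenspace (exteriorPower.map 8 ((2 * (m : ℂ)) • LinearMap.id + G))
            ((m : ℂ) ^ 8 * (2 + b₃) ^ 8) ⊔
          Module.End.eigenspace (exteriorPower.map 8 ((2 * (m : ℂ)) • LinearMap.id + G))
            ((m : ℂ) ^ 8 * (2 - b₃) ^ 8)) := by
    intro k
    have hfun : (⇑((((k : ℕ) : ℂ)) • (LinearMap.id : V →ₗ[ℂ] V) + F) ∘ v) =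
        fun i => ((((k : ℕ) : ℂ) + a) * α) • u i + (((k : ℕ) : ℂ) - a) • w i := by
      funext i
      rw [Function.comp_apply, LinearMap.add_apply, LinearMap.smul_apply, LinearMap.id_apply, hv]
      dsimp only
      rw [map_add, map_smul, hu, hw]
      module
    have hk : exteriorPower.map 8 ((((k : ℕ) : ℂ)) • (LinearMap.id : V →ₗ[ℂ] V) + F)
        (exteriorPower.ιMulti ℂ 8 v) = ω ((((k : ℕ) : ℂ) + a) * α) (((k : ℕ) : ℂ) - a) := by
      rw [exteriorPower.map_apply_ιMulti, hfun]
    rw [← hk]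
    exact Submodule.mem_iSup_of_mem k (Submodule.mem_map_of_mem (Submodule.mem_sup_left hvE))
  -- Veronese: every value of the binary octic `ω` lies in the span of the nine special values
  obtain ⟨E, hE⟩ := multilinear_pencil_expansion
    ((exteriorPower.ιMulti ℂ 8 : V [⋀^Fin 8]→ₗ[ℂ] (⋀[ℂ]^8 V)) :
      MultilinearMap ℂ (fun _ : Fin 8 => V) (⋀[ℂ]^8 V)) u w
  have hωE : ∀ α' β' : ℂ, ω α' β' = ∑ j ∈ Finset.range (8 + 1), (α' ^ j * β' ^ (8 - j)) • E j := by
    intro α' β'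
    rw [← hE α' β', hω_def, AlternatingMap.coe_multilinearMap]
  intro α' β'
  refine (Submodule.span_le.2 ?_) (veronese_mem_span ω E hωE
    (fun k : Fin (8 + 1) => (((k : ℕ) : ℂ) + a) * α) (fun k => ((k : ℕ) : ℂ) - a)
    (fun k => hka k) (nodes_injective ha0 hka hα0) α' β')
  rintro _ ⟨k, rfl⟩
  exact hωk k

end Summit.HodgeConjecture.HodgeConjecture.Theorems.HyperbolicEightfoldsSqrtMinus7.DicyclicQuaternionSwitch
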